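/-
Origin: expansion seat `planner-pub-hodgecm-mc-axioms-1-g14-0`, handover #W94 2026-08-20T15:53:55Z md5 4a273f1cf94b (PKG c09afacfa974 → 4a273f1cf94b; 396 l.; MECHANICAL (iib-R) rewrite v3.1 of the PKG file as it stands (5 token edits; rules R1x1+RX[h₂']x4)) (`HOME/mc/pub-hodgecm-mc-axioms-1-g14/revendor/kit-r55/stage55/HodgeCM/Model/ArchKTypeOfOrient.lean`, md5 4a273f1cf94b, 396 lines);
landed by the gen-22 packager (p-g22) in gate run 55 REPLACES the earlier landed copy of `HodgeCM/Model/ArchKTypeOfOrient.lean` (seat copy carried the packager Origin header of an earlier run (stripped)).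
-/
/-
Copyright (c) 2026. Released under Apache 2.0 license as described in the file LICENSE.
Cell pub-hodgecm, MODEL layer (construction prover mc-carch-1, gen 3), BINDER-OWNERS rows 12/15 — EVIDENCE LEAF for the (TWIST-2) /
orientation docket: what the two branches of Mathlib's place representative `(InfinitePlace.mk ι₁).embedding ∈ {ι₁, conj ∘ ι₁}` do to the
row-12 term of record (#CA14) and to E's row 15 along `BallForms.expP`.
-/
import Summits.HodgeConjecture.HodgeCM.Model.ArchKTypeOfSlotRec_2
import Summits.HodgeConjecture.HodgeCM.Model.ArchLineOrient

/-!
# The orientation of the literal slot: id branch vs conj branch of `(mk ι₁).embedding`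

Census-grade kernel facts (TYPE nil against E: no binder is produced or discharged here).  `ρ := (InfinitePlace.mk ι₁).embedding`.

* § 1 slope algebra for an archimedean `K`-type datum `B` along a chart `e : ℂ² → G₁` (generic): reversing a direction negates the
  slope (`tendsto_slope_neg`), and **(REP) along the conjugated chart `b ↦ e (star b)` at `v` is the `𝔭⁺`-SHAPE relation along `e` at
  `star v`** (`pPlusShape_of_isPMinusKilledAlong_star`: slopes `D`, `Dᵢ` at `star v`, `I • star v` with `D − I•Dᵢ = 0`);
  `pPlusShape_neg` moves it to `−star v`; `slopes_eq_zero_of_pPlusShape_of_isPMinusKilledAlong`: a direction carrying BOTH shapes has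
  both slopes `0`.
* § 2 at the pin (`X := thetaSpaceInputIn … S hV`, `G₁ = U21`): in the CONJ BRANCH `ρ ≠ ι₁` the twisted chart IS the conjugated chart
  (`twistU21_expP_eq_star`: `twistU21 (expP b) = expP (star b)`, from #CA10 `twistU21_expP`), hence every datum with (REP) along
  `twistU21 ∘ expP` at `−I•e_p` — #CA13/#CA14's literal-slot terms `archKTypeOfSlot{Zero,One}[Rec]`, HYPOTHESIS-FREE (`…_twist`) — carries the
  `𝔭⁺`-shape relation along `expP` at `−I•e_p` (`pPlusShape_expP_of_twist_of_embedding_ne`); if it ALSO satisfied E's row 15 there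
  (`IsPMinusKilledAlong expP (−I•e_p)`, glue-1 `_r20AE`'s `hk`), both slopes at `−I•e_p` and `e_p` would vanish
  (`slopes_expP_eq_zero_of_twist_of_isPMinusKilledAlong_of_embedding_ne`).
* § 3 the frame-matching input `hsec` of #CA11–#CA14 FORCES the id branch: `archSectionFrameOf_injective`, **`embedding_eq_of_hsec`**
  (witness `u₀ = diag(1, 1, i) ∈ Stab(x₀)`: `twistU21 u₀ = diag(1,1,−i) ≠ u₀` in the conj branch).
* § 4 the slot sign through `ι₁`: `cmXW … ⟨d⟩ … v₁ 0 > 0 ↔ 0 < re ι₁(d) · im ι₁(δ_L)` in the id branch and `↔ re ι₁(d) · im ι₁(δ_L) < 0` in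
  the conj branch ((F2) `cmXW_cmPlace_lineVec`), the ι₁-based bit `orientBitι L ι₁ := decide (im ι₁(δ_L) < 0)` with
  `orientBitι_conjugate : orientBitι L (conjugate ι₁) = !orientBitι L ι₁`, and under `GoodCtx h ι₁ c`:
  `hposₖ ↔ h = orientBitι L ι₁` (id branch) / `hposₖ ↔ h = !orientBitι L ι₁` (conj branch).

Nothing is cited and nothing is minted: kernel lemmas over installed RUN-39 modules; 0 records, 0 `def … : Prop` (one `Bool`-valued def).
-/

set_option autoImplicit false

noncomputable section

open Filter Topology Complex
open NumberField NumberField.InfinitePlace NumberField.mixedEmbedding IsDedekindDomain MeasureTheory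
open scoped Matrix TensorProduct Classical SchwartzMap ComplexConjugate
open MulAction
open Literature.Geometry.ComplexHyperbolic.BallModel (U21 x₀ stabilizerEquivK21 mat bmat blockU blockK stabilizerEquivK21_apply
  coe_blockK mat_blockU mat_injective)
open Literature.NumberTheory.Automorphic.U21 (K21 matA sclD)
open Literature.AlgebraicGeometry.HodgeTheory
open Literature.AlgebraicGeometry.ShimuraVarieties Literature.AlgebraicGeometry.ShimuraVarieties.BallForms
open Literature.NumberTheory.Automorphic Literature.NumberTheory.Weil1964
open Literature.RepresentationTheory.KonnoKonno2007 Literature.RepresentationTheory.KonnoKonno2007.RealDualPair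
open Literature.NumberTheory.GelbartRogawski1991 Literature.NumberTheory.GelbartRogawski1991.UnitaryDualPair
open Literature.Analysis.SegalBargmann Literature.Analysis.Distribution
open Literature.NumberTheory.Automorphic.PicardCM
open HodgeCM.Adelic HodgeCM.PerL34 HodgeCM.Model.HypCensus HodgeCM.Model.SupplyInstance HodgeCM.Model.ArchSideTerm

namespace HodgeCM.Model

/-! ## § 1 Slope algebra along a chart (generic archimedean `K`-type datum) -/

section Slopes

variable {U : Universe} {Lc : CMField} {ι₁ : Lc →+* ℂ} {V : HermSpace3 Lc ι₁} {c : SeesawCtx Lc}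
variable {X : ThetaSpaceInput U V c} {k : Fin 4} {N : ℕ}

/-- reversing time on the punctured neighbourhood of `0`. -/
theorem tendsto_neg_nhdsNE_zero : Tendsto (fun t : ℝ => -t) (𝓝[≠] (0 : ℝ)) (𝓝[≠] 0) := by
  refine tendsto_nhdsWithin_of_tendsto_nhds_of_eventually_within _ ?_ ?_
  · exact (continuous_neg.tendsto' (0 : ℝ) 0 neg_zero).mono_left nhdsWithin_le_nhds
  · exact eventually_nhdsWithin_of_forall fun t ht => Set.mem_compl_singleton_iff.mpr (neg_ne_zero.mpr ht)

/-- **reversing a direction negates the slope**: if `t⁻¹ • (G (t • w) − Φ) → D` then `t⁻¹ • (G (t • (−w)) − Φ) → −D` (`t → 0`, `t ≠ 0`). -/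
theorem tendsto_slope_neg {P' : Type*} [AddCommGroup P'] [Module ℝ P'] {M : Type*} [AddCommGroup M] [Module ℝ M]
    [TopologicalSpace M] [IsTopologicalAddGroup M] [ContinuousConstSMul ℝ M]
    (G : P' → M) (Φ : M) (w : P') {D : M}
    (h : Tendsto (fun t : ℝ => t⁻¹ • (G (t • w) - Φ)) (𝓝[≠] 0) (𝓝 D)) :
    Tendsto (fun t : ℝ => t⁻¹ • (G (t • (-w)) - Φ)) (𝓝[≠] 0) (𝓝 (-D)) := by
  have h' := (h.comp tendsto_neg_nhdsNE_zero).neg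
  refine h'.congr fun t => ?_
  simp only [Function.comp_apply, neg_smul, smul_neg, inv_neg, neg_neg]

namespace ArchKTypeData

variable (B : ArchKTypeData X k N)

/-- `star (t • v) = t • star v` for real `t` (coordinatewise complex conjugation on `ℂ²`). -/
theorem star_real_smul (t : ℝ) (v : Fin 2 → ℂ) : star (t • v) = t • star v := by
  ext i; simp

/-- `star (t • (I • v)) = t • (−(I • star v))`. -/
theorem star_real_smul_I_smul (t : ℝ) (v : Fin 2 → ℂ) : star (t • (Complex.I • v)) = t • (-(Complex.I • star v)) := by
  ext i; simp [Complex.conj_I]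

/-- **(REP) along the conjugated chart is the `𝔭⁺`-shape relation along the chart at the conjugate direction**:
from `B.IsPMinusKilledAlong (b ↦ e (star b)) v`, for every covector the slopes `D`, `Dᵢ` of `b ↦ ω_∞(e b) Φ_∞(ℓ)` at `0` in the
directions `star v`, `I • star v` exist and satisfy `D − I • Dᵢ = 0`. -/
theorem pPlusShape_of_isPMinusKilledAlong_star (e : (Fin 2 → ℂ) → X.G₁) (v : Fin 2 → ℂ)
    (h : B.IsPMinusKilledAlong (fun b => e (star b)) v) (ℓ : Module.Dual ℂ X.W) :
    ∃ D Dᵢ : 𝓢((X.J → mixedSpace X.K), ℂ),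
      Tendsto (fun t : ℝ => t⁻¹ • (B.ωinf (e (t • star v)) (B.Φarch ℓ) - B.Φarch ℓ)) (𝓝[≠] 0) (𝓝 D) ∧
      Tendsto (fun t : ℝ => t⁻¹ • (B.ωinf (e (t • (Complex.I • star v))) (B.Φarch ℓ) - B.Φarch ℓ)) (𝓝[≠] 0) (𝓝 Dᵢ) ∧
      D - Complex.I • Dᵢ = 0 := by
  obtain ⟨D₀, D₁, h0, h1, hsum⟩ := h ℓ
  refine ⟨D₀, -D₁, h0.congr fun t => ?_, ?_, ?_⟩
  · simp only [star_real_smul]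
  · -- the `I•v` family of the conjugated chart runs BACKWARDS along `I • star v`
    have h1' : Tendsto (fun t : ℝ => t⁻¹ • (B.ωinf (e (t • (-(Complex.I • star v)))) (B.Φarch ℓ) - B.Φarch ℓ)) (𝓝[≠] 0) (𝓝 D₁) :=
      h1.congr fun t => by simp only [star_real_smul_I_smul]
    have h2 := tendsto_slope_neg (fun b => B.ωinf (e b) (B.Φarch ℓ)) (B.Φarch ℓ) (-(Complex.I • star v)) h1'
    simpa only [neg_neg] using h2
  · rw [smul_neg, sub_neg_eq_add, hsum]

/-- the `𝔭⁺`-shape relation at `w` moves to `−w` (both slopes change sign). -/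
theorem pPlusShape_neg (e : (Fin 2 → ℂ) → X.G₁) (w : Fin 2 → ℂ) (ℓ : Module.Dual ℂ X.W)
    (h : ∃ D Dᵢ : 𝓢((X.J → mixedSpace X.K), ℂ),
      Tendsto (fun t : ℝ => t⁻¹ • (B.ωinf (e (t • w)) (B.Φarch ℓ) - B.Φarch ℓ)) (𝓝[≠] 0) (𝓝 D) ∧
      Tendsto (fun t : ℝ => t⁻¹ • (B.ωinf (e (t • (Complex.I • w))) (B.Φarch ℓ) - B.Φarch ℓ)) (𝓝[≠] 0) (𝓝 Dᵢ) ∧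
      D - Complex.I • Dᵢ = 0) :
    ∃ D Dᵢ : 𝓢((X.J → mixedSpace X.K), ℂ),
      Tendsto (fun t : ℝ => t⁻¹ • (B.ωinf (e (t • (-w))) (B.Φarch ℓ) - B.Φarch ℓ)) (𝓝[≠] 0) (𝓝 D) ∧
      Tendsto (fun t : ℝ => t⁻¹ • (B.ωinf (e (t • (Complex.I • (-w)))) (B.Φarch ℓ) - B.Φarch ℓ)) (𝓝[≠] 0) (𝓝 Dᵢ) ∧
      D - Complex.I • Dᵢ = 0 := by
  obtain ⟨D, Dᵢ, hD, hDᵢ, hsum⟩ := h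
  refine ⟨-D, -Dᵢ, tendsto_slope_neg (fun b => B.ωinf (e b) (B.Φarch ℓ)) (B.Φarch ℓ) w hD, ?_, ?_⟩
  · have h2 := tendsto_slope_neg (fun b => B.ωinf (e b) (B.Φarch ℓ)) (B.Φarch ℓ) (Complex.I • w) hDᵢ
    have ew : Complex.I • (-w) = -(Complex.I • w) := smul_neg _ _
    rw [ew]
    exact h2
  · have e' : -D - Complex.I • (-Dᵢ) = -(D - Complex.I • Dᵢ) := by rw [smul_neg]; abel
    rw [e', hsum, neg_zero]

/-- **a direction carrying both the `𝔭⁺`-shape and the `𝔭⁻` relation has both slopes `0`** (limits in `𝓢` are unique). -/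
theorem slopes_eq_zero_of_pPlusShape_of_isPMinusKilledAlong (e : (Fin 2 → ℂ) → X.G₁) (w : Fin 2 → ℂ) (ℓ : Module.Dual ℂ X.W)
    (hplus : ∃ D Dᵢ : 𝓢((X.J → mixedSpace X.K), ℂ),
      Tendsto (fun t : ℝ => t⁻¹ • (B.ωinf (e (t • w)) (B.Φarch ℓ) - B.Φarch ℓ)) (𝓝[≠] 0) (𝓝 D) ∧
      Tendsto (fun t : ℝ => t⁻¹ • (B.ωinf (e (t • (Complex.I • w))) (B.Φarch ℓ) - B.Φarch ℓ)) (𝓝[≠] 0) (𝓝 Dᵢ) ∧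
      D - Complex.I • Dᵢ = 0)
    (hminus : B.IsPMinusKilledAlong e w)
    {D Dᵢ : 𝓢((X.J → mixedSpace X.K), ℂ)}
    (hD : Tendsto (fun t : ℝ => t⁻¹ • (B.ωinf (e (t • w)) (B.Φarch ℓ) - B.Φarch ℓ)) (𝓝[≠] 0) (𝓝 D))
    (hDᵢ : Tendsto (fun t : ℝ => t⁻¹ • (B.ωinf (e (t • (Complex.I • w))) (B.Φarch ℓ) - B.Φarch ℓ)) (𝓝[≠] 0) (𝓝 Dᵢ)) :
    D = 0 ∧ Dᵢ = 0 := by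
  obtain ⟨D₁, D₁ᵢ, hD₁, hD₁ᵢ, hsum₁⟩ := hplus
  obtain ⟨D₂, D₂ᵢ, hD₂, hD₂ᵢ, hsum₂⟩ := hminus ℓ
  have e₁ : D₁ = D := tendsto_nhds_unique hD₁ hD
  have e₂ : D₂ = D := tendsto_nhds_unique hD₂ hD
  have e₁ᵢ : D₁ᵢ = Dᵢ := tendsto_nhds_unique hD₁ᵢ hDᵢ
  have e₂ᵢ : D₂ᵢ = Dᵢ := tendsto_nhds_unique hD₂ᵢ hDᵢ
  subst e₁ e₁ᵢ
  rw [e₂, e₂ᵢ] at hsum₂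
  have hD0 : (2 : ℂ) • D₁ = 0 := by
    rw [two_smul]
    calc D₁ + D₁ = (D₁ - Complex.I • D₁ᵢ) + (D₁ + Complex.I • D₁ᵢ) := by abel
      _ = 0 := by rw [hsum₁, hsum₂, add_zero]
  have hD : D₁ = 0 := by
    rcases smul_eq_zero.mp hD0 with h2 | h
    · exact absurd h2 two_ne_zero
    · exact h
  refine ⟨hD, ?_⟩
  have hI : Complex.I • D₁ᵢ = 0 := by rw [hD, zero_add] at hsum₂; exact hsum₂
  rcases smul_eq_zero.mp hI with hI0 | h
  · exact absurd hI0 Complex.I_ne_zero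
  · exact h

end ArchKTypeData

end Slopes

/-! ## § 2 At the pin: the conj branch turns #CA14's (REP) along `twistU21 ∘ expP` into the `𝔭⁺`-shape along `expP` -/

section PinTwist

variable {L : CMField} {ι₁ : L →+* ℂ}

/-- **in the conj branch the twisted chart is the conjugated chart**: `twistU21 (expP b) = expP (star b)`. -/
theorem twistU21_expP_eq_star (hne : (InfinitePlace.mk ι₁).embedding ≠ ι₁) (b : Fin 2 → ℂ) :
    twistU21 L ι₁ (expP b) = expP (star b) := by
  rw [twistU21_expP]
  congr 1
  funext i
  rw [UnitaryGroup.embTwist_apply_of_ne (L : Type) ι₁ hne, Pi.star_apply, Complex.star_def]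

/-- in the id branch it is the chart itself (#CA13 `twistU21_eq_self_of_embedding_eq`, recorded as charts). -/
theorem twistU21_expP_eq_self (heq : (InfinitePlace.mk ι₁).embedding = ι₁) (b : Fin 2 → ℂ) :
    twistU21 L ι₁ (expP b) = expP b :=
  twistU21_eq_self_of_embedding_eq heq _

/-- `star (−I • e_p) = I • e_p` on `ℂ²`. -/
theorem star_negI_single (p : Fin 2) :
    star (-Complex.I • (Pi.single p 1 : Fin 2 → ℂ)) = Complex.I • (Pi.single p 1 : Fin 2 → ℂ) := by
  ext i
  fin_cases p <;> fin_cases i <;> simp [Complex.conj_I]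

variable (hHD : exists_isReal_hodgeModel) (hI : hodgePQ_independent_of_hodgeModel)
  (h₁ : BallQuotientUniformised)  (h₃ : CMAbelianVarietyRealised)
variable {V : HermSpace3 L ι₁} {c : SeesawCtx L} {S : ThetaAdelicSide V c} {hV : IsAnisotropic L V.Hm} {k : Fin 4} {N : ℕ}
  (B : ArchKTypeData (thetaSpaceInputIn hHD hI h₁ h₃ S hV) k N)

/-- **CONJ BRANCH ⇒ `𝔭⁺`-SHAPE ALONG `expP`.**  For ANY archimedean `K`-type datum at the pin with (REP) along the twisted chart
`twistU21 ∘ expP` at `−I • e_p` — #CA13/#CA14's literal-slot terms `archKTypeOfSlot{Zero,One}[Rec]` have this HYPOTHESIS-FREE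
(`isPMinusKilledAlong_archKTypeOfSlot…_twist`) — in the branch `(mk ι₁).embedding ≠ ι₁` the slopes of `b ↦ ω_∞(expP b) Φ_∞(ℓ)` at
`−I • e_p`, `I • (−I • e_p) = e_p` exist and satisfy the `𝔭⁺`-shape relation `D − I • Dᵢ = 0` (E's row 15 asks `D + I • Dᵢ = 0`). -/
theorem ArchKTypeData.pPlusShape_expP_of_twist_of_embedding_ne (hne : (InfinitePlace.mk ι₁).embedding ≠ ι₁) (p : Fin 2)
    (htw : B.IsPMinusKilledAlong (fun b => twistU21 L ι₁ (expP b)) (-Complex.I • (Pi.single p 1 : Fin 2 → ℂ)))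
    (ℓ : Module.Dual ℂ (thetaSpaceInputIn hHD hI h₁ h₃ S hV).W) :
    ∃ D Dᵢ : 𝓢((Fin 3 → mixedSpace (↥(maximalRealSubfield L))), ℂ),
      Tendsto (fun t : ℝ => t⁻¹ • (B.ωinf (expP (t • (-Complex.I • (Pi.single p 1 : Fin 2 → ℂ)))) (B.Φarch ℓ) - B.Φarch ℓ))
        (𝓝[≠] 0) (𝓝 D) ∧
      Tendsto (fun t : ℝ => t⁻¹ • (B.ωinf (expP (t • (Complex.I • (-Complex.I • (Pi.single p 1 : Fin 2 → ℂ))))) (B.Φarch ℓ) - B.Φarch ℓ))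
        (𝓝[≠] 0) (𝓝 Dᵢ) ∧
      D - Complex.I • Dᵢ = 0 := by
  have hchart : (fun b : Fin 2 → ℂ => twistU21 L ι₁ (expP b)) = fun b => expP (star b) := funext (twistU21_expP_eq_star hne)
  rw [hchart] at htw
  have h := B.pPlusShape_of_isPMinusKilledAlong_star (e := (expP : (Fin 2 → ℂ) → U21)) _ htw ℓ
  rw [star_negI_single] at h
  obtain ⟨D, Dᵢ, hD, hDᵢ, hs⟩ := B.pPlusShape_neg (e := (expP : (Fin 2 → ℂ) → U21)) _ ℓ h
  have ev : -Complex.I • (Pi.single p 1 : Fin 2 → ℂ) = -(Complex.I • (Pi.single p 1 : Fin 2 → ℂ)) := neg_smul _ _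
  refine ⟨D, Dᵢ, ?_, ?_, hs⟩
  · rw [ev]; exact hD
  · rw [ev]; exact hDᵢ

/-- **… so E's row 15 at the same datum forces flat slopes**: if in the conj branch the datum ALSO satisfies
`IsPMinusKilledAlong expP (−I • e_p)` (glue-1 `_r20AE`'s `hk` at `p`), every slope of `b ↦ ω_∞(expP b) Φ_∞(ℓ)` at `−I • e_p` and at
`e_p` is `0`. -/
theorem ArchKTypeData.slopes_expP_eq_zero_of_twist_of_isPMinusKilledAlong_of_embedding_ne
    (hne : (InfinitePlace.mk ι₁).embedding ≠ ι₁) (p : Fin 2)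
    (htw : B.IsPMinusKilledAlong (fun b => twistU21 L ι₁ (expP b)) (-Complex.I • (Pi.single p 1 : Fin 2 → ℂ)))
    (hk : B.IsPMinusKilledAlong expP (-Complex.I • (Pi.single p 1 : Fin 2 → ℂ)))
    (ℓ : Module.Dual ℂ (thetaSpaceInputIn hHD hI h₁ h₃ S hV).W) {D Dᵢ : 𝓢((Fin 3 → mixedSpace (↥(maximalRealSubfield L))), ℂ)}
    (hD : Tendsto (fun t : ℝ => t⁻¹ • (B.ωinf (expP (t • (-Complex.I • (Pi.single p 1 : Fin 2 → ℂ)))) (B.Φarch ℓ) - B.Φarch ℓ))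
      (𝓝[≠] 0) (𝓝 D))
    (hDᵢ : Tendsto (fun t : ℝ => t⁻¹ • (B.ωinf (expP (t • (Complex.I • (-Complex.I • (Pi.single p 1 : Fin 2 → ℂ))))) (B.Φarch ℓ) - B.Φarch ℓ))
      (𝓝[≠] 0) (𝓝 Dᵢ)) :
    D = 0 ∧ Dᵢ = 0 :=
  B.slopes_eq_zero_of_pPlusShape_of_isPMinusKilledAlong (e := (expP : (Fin 2 → ℂ) → U21)) _ ℓ
    (B.pPlusShape_expP_of_twist_of_embedding_ne hHD hI h₁ h₃ hne p htw ℓ) hk hD hDᵢ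

end PinTwist

/-! ## § 3 The frame-matching input `hsec` forces the id branch -/

section Hsec

variable {L : CMField} {ι₁ : L →+* ℂ} (V : HermSpace3 L ι₁)

/-- `archSectionFrameOf V : U21 →* U(diag (frameD V))(L ⊗ ℝ)` is injective (frame transport of #1097's injective section). -/
theorem archSectionFrameOf_injective : Function.Injective (archSectionFrameOf V) := by
  intro u u' h
  have h' := congrArg (UnitaryGroup.archToAdelic (↥(maximalRealSubfield L)) L (IsCMField.complexConj L) 3 (Matrix.diagonal (frameD V))) h
  rw [← cmFrameEquiv_archSectionU21CM, ← cmFrameEquiv_archSectionU21CM] at h'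
  exact UnitaryGroup.archSectionU21CM_injective (L : Type) ι₁ V.Hm V.sylvesterFrame (sylvesterFrame_J V)
    ((cmFrameEquiv (L : Type) (frameG V) V.Hm (frameD V) (frame_congr V)).injective h')

/-- the witness `i ∈ U(1)`. -/
def unitI : unitary ℂ := ⟨Complex.I, by rw [Unitary.mem_iff]; simp [Complex.conj_I]⟩

/-- (Ported verbatim from the HodgeCMPerL package; no docstring in the source.) -/
@[simp] theorem coe_unitI : (unitI : ℂ) = Complex.I := rfl

/-- the witness `u₀ := diag(1, 1, i) ∈ Stab(x₀)`. -/
def stabWitness : stabilizer U21 x₀ := stabilizerEquivK21 ((1 : Matrix.unitaryGroup (Fin 2) ℂ), unitI)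

/-- (Ported verbatim from the HodgeCMPerL package; no docstring in the source.) -/
theorem mat_stabWitness : mat (stabWitness : U21) = bmat 1 Complex.I := by
  show mat ((stabilizerEquivK21 ((1 : Matrix.unitaryGroup (Fin 2) ℂ), unitI) : stabilizer U21 x₀) : U21) = _
  rw [stabilizerEquivK21_apply, coe_blockK, mat_blockU]
  rfl

/-- in the conj branch the witness MOVES under the twist: `twistU21 u₀ ≠ u₀` (`conj i ≠ i`). -/
theorem twistU21_stabWitness_ne (hne : (InfinitePlace.mk ι₁).embedding ≠ ι₁) :
    twistU21 L ι₁ (stabWitness : U21) ≠ (stabWitness : U21) := by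
  intro h
  have h22 := congrFun (congrFun (congrArg mat h) 2) 2
  rw [mat_twistU21, Matrix.map_apply, mat_stabWitness, UnitaryGroup.embTwist_apply_of_ne (L : Type) ι₁ hne] at h22
  have : (bmat 1 Complex.I : Matrix (Fin 3) (Fin 3) ℂ) 2 2 = Complex.I := by simp [bmat]
  rw [this, Complex.conj_I] at h22
  have him := congrArg Complex.im h22
  norm_num at him

variable {M' : ℕ} (dW : Fin M' → (L : Type)) (hdW : ∀ i, IsCMField.complexConj (L : Type) (dW i) = dW i) (hdW0 : ∀ i, dW i ≠ 0)
variable {R' S' : Type} [Fintype R'] [DecidableEq R'] [Fintype S'] [DecidableEq S']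
  (eR : PosIdx (cmXW (L : Type) (frameD V) dW hdW ι₁ (cmPlace (L : Type) ι₁)) ≃ R')
  (eS : NegIdx (cmXW (L : Type) (frameD V) dW hdW ι₁ (cmPlace (L : Type) ι₁)) ≃ S')

/-- **the frame-matching input `hsec` of #CA11–#CA14 FORCES the id branch** `(mk ι₁).embedding = ι₁`: with #CA13
`hsec_of_embedding_eq` this makes `hsec` EQUIVALENT to the id branch — it is FALSE at every conj-branch embedding (witness `diag(1,1,i)`). -/
theorem embedding_eq_of_hsec
    (hsec : ∀ u : stabilizer U21 x₀,
      cmBlockSectionAt (L : Type) (frameD V) (frameD_real V) (frameD_ne V) dW hdW hdW0 ι₁ (cmPlace (L : Type) ι₁) (blockPosEquiv V)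
          (blockNegEquiv V) eR eS (u21FrameEquiv (u : U21), 1) = (archSectionFrameOf V u, 1)) :
    (InfinitePlace.mk ι₁).embedding = ι₁ := by
  by_contra hne
  have h := hsec stabWitness
  rw [cmBlockSectionAt_u21FrameEquiv] at h
  exact twistU21_stabWitness_ne hne (archSectionFrameOf_injective V (Prod.mk.inj h).1)

/-- `hsec ↔ id branch`. -/
theorem hsec_iff_embedding_eq :
    (∀ u : stabilizer U21 x₀,
      cmBlockSectionAt (L : Type) (frameD V) (frameD_real V) (frameD_ne V) dW hdW hdW0 ι₁ (cmPlace (L : Type) ι₁) (blockPosEquiv V)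
          (blockNegEquiv V) eR eS (u21FrameEquiv (u : U21), 1) = (archSectionFrameOf V u, 1)) ↔
      (InfinitePlace.mk ι₁).embedding = ι₁ :=
  ⟨embedding_eq_of_hsec V dW hdW hdW0 eR eS, fun h u => hsec_of_embedding_eq V dW hdW hdW0 eR eS h u⟩

end Hsec

/-! ## § 4 The slot sign through `ι₁`, and the ι₁-based orientation bit -/

section Orient

variable {L : CMField} {ι₁ : L →+* ℂ} (V : HermSpace3 L ι₁)

/-- in the id branch `im ρ(δ_L) = im ι₁(δ_L)`. -/
theorem im_embedding_imagUnit_of_eq (heq : (InfinitePlace.mk ι₁).embedding = ι₁) :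
    ((InfinitePlace.mk ι₁).embedding (imagUnit (L : Type))).im = (ι₁ (imagUnit (L : Type))).im := by rw [heq]

/-- in the conj branch `im ρ(δ_L) = − im ι₁(δ_L)`. -/
theorem im_embedding_imagUnit_of_ne (hne : (InfinitePlace.mk ι₁).embedding ≠ ι₁) :
    ((InfinitePlace.mk ι₁).embedding (imagUnit (L : Type))).im = -(ι₁ (imagUnit (L : Type))).im := by
  rw [UnitaryGroup.embedding_mk_eq_conjugate_of_ne (L : Type) ι₁ hne, ComplexEmbedding.conjugate_coe_eq, Complex.conj_im]

/-- `im ι₁(δ_L) ≠ 0`. -/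
theorem im_apply_imagUnit_ne_zero : (ι₁ (imagUnit (L : Type))).im ≠ 0 := by
  by_cases heq : (InfinitePlace.mk ι₁).embedding = ι₁
  · rw [← im_embedding_imagUnit_of_eq heq]; exact im_embedding_mk_imagUnit_ne_zero
  · have h := im_embedding_mk_imagUnit_ne_zero (ι₁ := ι₁)
    rw [im_embedding_imagUnit_of_ne heq] at h
    exact fun h0 => h (by rw [h0, neg_zero])

/-- **ID BRANCH: line `⟨d⟩` reads positive at `v₁` iff `0 < re ι₁(d) · im ι₁(δ_L)`.** -/
theorem cmXW_pos_iff_of_embedding_eq (heq : (InfinitePlace.mk ι₁).embedding = ι₁) (d : (L : Type))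
    (hd : IsCMField.complexConj L d = d) :
    0 < cmXW (L : Type) (frameD V) (lineVec (L : Type) d) (fun _ => hd) ι₁ (HypCensus.cmPlace (L : Type) ι₁) 0 ↔
      0 < (ι₁ d).re * (ι₁ (imagUnit (L : Type))).im := by
  rw [cmXW_cmPlace_lineVec V d hd, im_embedding_imagUnit_of_eq heq, div_pos_iff, mul_pos_iff]

/-- **CONJ BRANCH: line `⟨d⟩` reads positive at `v₁` iff `re ι₁(d) · im ι₁(δ_L) < 0`.** -/
theorem cmXW_pos_iff_of_embedding_ne (hne : (InfinitePlace.mk ι₁).embedding ≠ ι₁) (d : (L : Type))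
    (hd : IsCMField.complexConj L d = d) :
    0 < cmXW (L : Type) (frameD V) (lineVec (L : Type) d) (fun _ => hd) ι₁ (HypCensus.cmPlace (L : Type) ι₁) 0 ↔
      (ι₁ d).re * (ι₁ (imagUnit (L : Type))).im < 0 := by
  rw [cmXW_cmPlace_lineVec V d hd, im_embedding_imagUnit_of_ne hne, div_neg, neg_pos, div_neg_iff, mul_neg_iff]

/-- **the ι₁-based orientation bit**: `true` iff `im ι₁(δ_L) < 0` — a function of the EMBEDDING, not of the place. -/
def orientBitι (L : CMField) (ι₁ : L →+* ℂ) : Bool := decide ((ι₁ (imagUnit (L : Type))).im < 0)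

/-- (Ported verbatim from the HodgeCMPerL package; no docstring in the source.) -/
theorem orientBitι_eq_true_iff : orientBitι L ι₁ = true ↔ (ι₁ (imagUnit (L : Type))).im < 0 := by
  simp [orientBitι]

/-- (Ported verbatim from the HodgeCMPerL package; no docstring in the source.) -/
theorem orientBitι_eq_false_iff : orientBitι L ι₁ = false ↔ 0 < (ι₁ (imagUnit (L : Type))).im := by
  rw [orientBitι, decide_eq_false_iff_not, not_lt]
  exact ⟨fun h => lt_of_le_of_ne h (im_apply_imagUnit_ne_zero (ι₁ := ι₁)).symm, le_of_lt⟩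

/-- **the bit FLIPS under conjugation of the embedding** (the two embeddings over one complex place give complex-conjugate balls). -/
theorem orientBitι_conjugate : orientBitι L (ComplexEmbedding.conjugate ι₁) = !orientBitι L ι₁ := by
  have hne := im_apply_imagUnit_ne_zero (L := L) (ι₁ := ι₁)
  cases hb : orientBitι L ι₁
  · rw [orientBitι_eq_false_iff] at hb
    rw [Bool.not_false, orientBitι_eq_true_iff, ComplexEmbedding.conjugate_coe_eq, Complex.conj_im, neg_lt_zero]
    exact hb
  · rw [orientBitι_eq_true_iff] at hb
    rw [Bool.not_true, orientBitι_eq_false_iff, ComplexEmbedding.conjugate_coe_eq, Complex.conj_im, neg_pos]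
    exact hb

/-- `(0 < im ι₁(δ_L) ↔ h = false) ↔ h = orientBitι L ι₁`. -/
theorem orient_iff_eq_orientBitι (h : Bool) :
    (0 < (ι₁ (imagUnit (L : Type))).im ↔ h = false) ↔ h = orientBitι L ι₁ := by
  cases h <;> cases hb : orientBitι L ι₁ <;>
    simp only [orientBitι_eq_false_iff, orientBitι_eq_true_iff, Bool.true_eq_false, Bool.false_eq_true, iff_false, iff_true,
      not_lt, not_le] at hb ⊢
  · exact hb
  · exact hb.le
  · exact hb
  · exact hb.le

/-- **ID BRANCH, under a good context: `hposₖ ↔ h = orientBitι L ι₁`** ((F2) `hpos_iff_orient_of_goodCtx` read through `ι₁`). -/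
theorem hpos_iff_eq_orientBitι_of_goodCtx_of_embedding_eq (heq : (InfinitePlace.mk ι₁).embedding = ι₁) {h : Bool}
    {c : SeesawCtx L} (hc : SignRecipe.GoodCtx h ι₁ c) (i : Fin 4) (hd : IsCMField.complexConj L (c.D.a i) = c.D.a i) :
    0 < cmXW (L : Type) (frameD V) (lineVec (L : Type) (c.D.a i)) (fun _ => hd) ι₁ (HypCensus.cmPlace (L : Type) ι₁) 0 ↔
      h = orientBitι L ι₁ := by
  rw [hpos_iff_orient_of_goodCtx V hc i hd, im_embedding_imagUnit_of_eq heq, orient_iff_eq_orientBitι]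

/-- **CONJ BRANCH, under a good context: `hposₖ ↔ h = !orientBitι L ι₁`** — the literal slot is reached by the OPPOSITE bit. -/
theorem hpos_iff_eq_not_orientBitι_of_goodCtx_of_embedding_ne (hne : (InfinitePlace.mk ι₁).embedding ≠ ι₁) {h : Bool}
    {c : SeesawCtx L} (hc : SignRecipe.GoodCtx h ι₁ c) (i : Fin 4) (hd : IsCMField.complexConj L (c.D.a i) = c.D.a i) :
    0 < cmXW (L : Type) (frameD V) (lineVec (L : Type) (c.D.a i)) (fun _ => hd) ι₁ (HypCensus.cmPlace (L : Type) ι₁) 0 ↔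
      h = !orientBitι L ι₁ := by
  rw [hpos_iff_orient_of_goodCtx V hc i hd, im_embedding_imagUnit_of_ne hne, neg_pos, ← orientBitι_conjugate,
    ← orient_iff_eq_orientBitι h, ComplexEmbedding.conjugate_coe_eq, Complex.conj_im, neg_pos]

end Orient

end HodgeCM.Model

end
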